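import Mathlib.MeasureTheory.Function.Jacobian
import Mathlib.MeasureTheory.Measure.Lebesgue.EqHaar
import Mathlib.Topology.Algebra.Module.FiniteDimension
import Mathlib.Analysis.Calculus.FDeriv.Prod
import Mathlib.Analysis.Calculus.FDeriv.Mul
import Mathlib.Analysis.Calculus.FDeriv.Linear
import Mathlib.Analysis.Calculus.FDeriv.Comp
import Mathlib.Analysis.Calculus.FDeriv.Add
import Mathlib.Analysis.Calculus.Deriv.Inv
import HarnessLib

/-!
# The easy case of Sard's theorem: images of lower-dimensional sets are null; generic parameters
# for affine conditions

Topic `Literature/Topology/FourManifolds`; general-position toolkit (used by the tree's proof of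
Whitney's theorem that homotopic embedded circles in a manifold of dimension `≥ 4` are isotopic,
leaf `Literature.Topology.FourManifolds.Milnor1965_isAmbientIsotopic_of_simplyConnected` of
`HCobordismAuxiliaryPair.lean`).  Everything here is proved:

* `Literature.Topology.FourManifolds.addHaar_image_eq_zero_of_finrank_lt` — **easy Sard**: if
  `dim X < dim Y` then the image of any set `s ⊆ X` under a map `f : X → Y` differentiable on `s`
  is Lebesgue-null in `Y` (Milnor, *Topology from the differentiable viewpoint* (1965), §2 and
  §3, Lemma 1 of the proof of Sard's theorem in the trivial case; Hirsch, *Differential Topology*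
  (1976), Ch. 3, Prop. 1.2: "`f(U)` has measure zero if `dim U < dim N`").  Proof: factor `f|s`
  through the proper subspace `X × 0 ⊆ X × ℝᵈ ≅ Y`, which is null, and apply Mathlib's
  `MeasureTheory.addHaar_image_eq_zero_of_differentiableOn_of_addHaar_eq_zero` (a differentiable
  self-map of `Y` preserves null sets).
* `Literature.Topology.FourManifolds.addHaar_setOf_exists_smul_add_smul_eq` — **generic
  parameters for a family of affine conditions**: given coefficient functions `a b : X → ℝ` and
  `Δ : X → V`, differentiable on `P ⊆ X`, with `dim X < dim V`, the set of parameters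
  `(v, w) ∈ V × V` for which `a p • v + b p • w = Δ p` for some `p ∈ P` with `(a p, b p) ≠ 0` is
  null: solving for `v` (where `a p ≠ 0`) or for `w` (where `b p ≠ 0`) exhibits it as the union
  of two differentiable images of subsets of `X × V`, of dimension `< 2 dim V`.
* `Literature.Topology.FourManifolds.exists_mem_notMem_of_measure_zero` — a null set omits a
  point of every nonempty open set (for measures positive on open sets).

## References

* J. Milnor, *Topology from the differentiable viewpoint* (1965), §§2–3. [MilnorTDV1965]
* M. W. Hirsch, *Differential Topology*, GTM 33 (1976), Ch. 3 §1 (Prop. 1.2, Thm. 1.3).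
  [HirschDT1976]
-/

open Set Function Module
open _root_.MeasureTheory _root_.MeasureTheory.Measure

noncomputable section

namespace Literature.Topology.FourManifolds

variable {X Y : Type*} [NormedAddCommGroup X] [NormedSpace ℝ X] [FiniteDimensional ℝ X]
  [NormedAddCommGroup Y] [NormedSpace ℝ Y] [FiniteDimensional ℝ Y] [MeasurableSpace Y]
  [BorelSpace Y]

/-- **Easy Sard: differentiable images of lower-dimensional sets are null.**  If
`dim X < dim Y` (finite-dimensional real normed spaces) and `f : X → Y` is differentiable on
`s ⊆ X`, then `f '' s` has measure zero for every additive Haar measure on `Y`.  (Milnor,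
*Topology from the differentiable viewpoint*, §3, the case `n < p` of Sard's theorem; Hirsch
(1976), Ch. 3, Prop. 1.2.)  Proof: with `X × ℝᵈ ≅ Y` (`d = dim Y - dim X > 0`),
`f '' s = (f ∘ pr₁ ∘ Φ⁻¹) '' (Φ (s × 0))` and `Φ (X × 0)` is a proper subspace, hence null
(`Measure.addHaar_submodule`); a differentiable map sends null sets to null sets
(`addHaar_image_eq_zero_of_differentiableOn_of_addHaar_eq_zero`).
[cite: MilnorTDV1965, §3 (Sard's theorem, case n < p)] -/
theorem addHaar_image_eq_zero_of_finrank_lt (μ : Measure Y) [IsAddHaarMeasure μ]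
    (h : finrank ℝ X < finrank ℝ Y) {f : X → Y} {s : Set X} (hf : DifferentiableOn ℝ f s) :
    μ (f '' s) = 0 := by
  set d : ℕ := finrank ℝ Y - finrank ℝ X with hd
  have hdim : finrank ℝ (X × (Fin d → ℝ)) = finrank ℝ Y := by
    rw [finrank_prod, finrank_fin_fun, hd]
    omega
  set Φ : (X × (Fin d → ℝ)) ≃L[ℝ] Y := ContinuousLinearEquiv.ofFinrankEq hdim with hΦ
  set ι : X → Y := fun x => Φ (x, 0) with hι
  set π : Y → X := fun y => (Φ.symm y).1 with hπ
  have hπι : ∀ x, π (ι x) = x := fun x => by simp [hπ, hι]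
  -- `f '' s` is the image of `ι '' s` under the differentiable map `f ∘ π`
  have himage : f '' s = (f ∘ π) '' (ι '' s) := by
    rw [image_image]
    exact image_congr fun x _ => by simp only [comp_apply, hπι]
  -- `ι '' s` lies in a proper subspace
  set R : Submodule ℝ Y := LinearMap.range ((Φ : (X × (Fin d → ℝ)) →L[ℝ] Y).toLinearMap ∘ₗ
    LinearMap.inl ℝ X (Fin d → ℝ)) with hR
  have hsub : ι '' s ⊆ (R : Set Y) := by
    rintro _ ⟨x, -, rfl⟩
    exact ⟨x, rfl⟩
  have hRne : R ≠ ⊤ := by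
    intro htop
    have hinj : Injective ((Φ : (X × (Fin d → ℝ)) →L[ℝ] Y).toLinearMap ∘ₗ
        LinearMap.inl ℝ X (Fin d → ℝ)) :=
      Φ.injective.comp LinearMap.inl_injective
    have h1 : finrank ℝ R = finrank ℝ X := LinearMap.finrank_range_of_inj hinj
    have h2 : finrank ℝ R = finrank ℝ Y := by rw [htop, finrank_top]
    omega
  have hnull : μ (ι '' s) = 0 := measure_mono_null hsub (addHaar_submodule μ R hRne)
  -- differentiability of `f ∘ π` on `ι '' s`
  have hπd : Differentiable ℝ π :=
    ((ContinuousLinearMap.fst ℝ X (Fin d → ℝ)).comp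
      (Φ.symm : Y →L[ℝ] X × (Fin d → ℝ))).differentiable
  have hcomp : DifferentiableOn ℝ (f ∘ π) (ι '' s) := by
    refine hf.comp hπd.differentiableOn ?_
    rintro _ ⟨x, hx, rfl⟩
    simpa only [hπι] using hx
  rw [himage]
  exact addHaar_image_eq_zero_of_differentiableOn_of_addHaar_eq_zero μ hcomp hnull

/-- **Generic parameters for a family of affine conditions.**  Let `a b : X → ℝ` and
`Δ : X → V` be differentiable on `P ⊆ X`, with `dim X < dim V`.  Then the set of
`(v, w) ∈ V × V` such that `a p • v + b p • w = Δ p` for some `p ∈ P` at which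
`(a p, b p) ≠ (0, 0)` is null for every additive Haar measure on `V × V`: where `a p ≠ 0` the
condition reads `v = (a p)⁻¹ • (Δ p - b p • w)`, where `b p ≠ 0` it reads
`w = (b p)⁻¹ • (Δ p - a p • v)`, so the set is covered by two differentiable images of subsets of
`X × V`, and `dim (X × V) < dim (V × V)` (`addHaar_image_eq_zero_of_finrank_lt`).  This is the
form in which "general position" is used for one-parameter families of curves (Whitney (1936),
§§5–8; Hirsch (1976), Ch. 3, Thm. 2.5 / Ex. 14 of Ch. 8 §1). [folklore] -/
theorem addHaar_setOf_exists_smul_add_smul_eq {V : Type*} [NormedAddCommGroup V]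
    [NormedSpace ℝ V] [FiniteDimensional ℝ V] [MeasurableSpace V] [BorelSpace V]
    (μ : Measure (V × V)) [IsAddHaarMeasure μ] (hXV : finrank ℝ X < finrank ℝ V)
    {P : Set X} {a b : X → ℝ} {Δ : X → V}
    (ha : DifferentiableOn ℝ a P) (hb : DifferentiableOn ℝ b P) (hΔ : DifferentiableOn ℝ Δ P) :
    μ {q : V × V | ∃ p ∈ P, (a p ≠ 0 ∨ b p ≠ 0) ∧ a p • q.1 + b p • q.2 = Δ p} = 0 := by
  have hdim : finrank ℝ (X × V) < finrank ℝ (V × V) := by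
    rw [finrank_prod, finrank_prod]
    omega
  -- the two parametrisations
  set D₁ : Set (X × V) := {z | z.1 ∈ P ∧ a z.1 ≠ 0} with hD₁
  set D₂ : Set (X × V) := {z | z.1 ∈ P ∧ b z.1 ≠ 0} with hD₂
  set Φ₁ : X × V → V × V := fun z => ((a z.1)⁻¹ • (Δ z.1 - b z.1 • z.2), z.2) with hΦ₁
  set Φ₂ : X × V → V × V := fun z => (z.2, (b z.1)⁻¹ • (Δ z.1 - a z.1 • z.2)) with hΦ₂
  have haf : DifferentiableOn ℝ (fun z : X × V => a z.1) (Prod.fst ⁻¹' P) :=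
    ha.comp differentiableOn_fst fun z hz => hz
  have hbf : DifferentiableOn ℝ (fun z : X × V => b z.1) (Prod.fst ⁻¹' P) :=
    hb.comp differentiableOn_fst fun z hz => hz
  have hΔf : DifferentiableOn ℝ (fun z : X × V => Δ z.1) (Prod.fst ⁻¹' P) :=
    hΔ.comp differentiableOn_fst fun z hz => hz
  have hD₁P : D₁ ⊆ Prod.fst ⁻¹' P := fun z hz => hz.1
  have hD₂P : D₂ ⊆ Prod.fst ⁻¹' P := fun z hz => hz.1
  have hΦ₁d : DifferentiableOn ℝ Φ₁ D₁ := by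
    refine DifferentiableOn.prodMk ?_ differentiableOn_snd
    refine DifferentiableOn.smul ((haf.mono hD₁P).inv fun z hz => hz.2) ?_
    exact (hΔf.mono hD₁P).sub ((hbf.mono hD₁P).smul differentiableOn_snd)
  have hΦ₂d : DifferentiableOn ℝ Φ₂ D₂ := by
    refine DifferentiableOn.prodMk differentiableOn_snd ?_
    refine DifferentiableOn.smul ((hbf.mono hD₂P).inv fun z hz => hz.2) ?_
    exact (hΔf.mono hD₂P).sub ((haf.mono hD₂P).smul differentiableOn_snd)
  have h1 : μ (Φ₁ '' D₁) = 0 := addHaar_image_eq_zero_of_finrank_lt μ hdim hΦ₁d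
  have h2 : μ (Φ₂ '' D₂) = 0 := addHaar_image_eq_zero_of_finrank_lt μ hdim hΦ₂d
  refine measure_mono_null ?_ (measure_union_null h1 h2)
  rintro ⟨v, w⟩ ⟨p, hp, hab, heq⟩
  rcases hab with ha0 | hb0
  · refine Or.inl ⟨(p, w), ⟨hp, ha0⟩, ?_⟩
    simp only [hΦ₁, Prod.mk.injEq, and_true]
    rw [← heq, add_sub_cancel_right, smul_smul, inv_mul_cancel₀ ha0, one_smul]
  · refine Or.inr ⟨(p, v), ⟨hp, hb0⟩, ?_⟩
    simp only [hΦ₂, Prod.mk.injEq, true_and]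
    rw [← heq, add_sub_cancel_left, smul_smul, inv_mul_cancel₀ hb0, one_smul]

/-- **A null set omits a point of every nonempty open set**, for a measure positive on nonempty
open sets (e.g. an additive Haar measure). [folklore] -/
theorem exists_mem_notMem_of_measure_zero {α : Type*} [MeasurableSpace α] [TopologicalSpace α]
    (μ : Measure α) [μ.IsOpenPosMeasure] {O S : Set α} (hO : IsOpen O) (hne : O.Nonempty)
    (hS : μ S = 0) : ∃ q ∈ O, q ∉ S := by
  have h : ¬ O ⊆ S := fun h => (hO.measure_pos μ hne).ne' (measure_mono_null h hS)
  obtain ⟨q, hq, hqS⟩ := not_subset.1 h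
  exact ⟨q, hq, hqS⟩

end Literature.Topology.FourManifolds
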